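import Summits.ValiantsHypothesis.ValiantsHypothesis.Theses.ShallowShadows
import Literature.Computability.AlgebraicComplexity.VPDeterminantalQPProofs
import Literature.Computability.Complexity.KWProtocol
import Summits.ValiantsHypothesis.ValiantsHypothesis.Theorems.ShallowShadowsShadowFormulaTransferStubKwFormula
import Summits.ValiantsHypothesis.ValiantsHypothesis.Theorems.ShallowShadowsShadowFormulaTransferDetProtocolRegimes

/-!
# Line `det-kw` — crux `ShadowFormulaTransfer` (item `stmt-ValiantsHypothesis-17124`)

Route `route-ValiantsHypothesis-ShallowShadows`, crux
`Summit.ValiantsHypothesis.ValiantsHypothesis.Theses.ShallowShadows.ShadowFormulaTransfer`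
(SHALLOW SHADOWS, degree-calibrated formula form: `∃ δ > 0, C` such that every `0/1`-coefficient
`VP_ℂ` family `f` has, eventually in `n`, monotone FORMULA size of its shadow
`B(f_n) : a ↦ [∃ m ∈ supp f_n, supp m ⊆ a]` at most `2^((deg f_n)^(1-δ) (log(n+2))^C + C)`).

An ALTERNATIVE line to `Lines/birth.lean` (Valiant normal form + shallow domination). Mechanism:
**kill the circuit, keep one matrix; trade formula size for an interactive protocol.**

* REDUCTION (proved here, from the tree): by the in-tree discharge of BCS 1997 Thm. (21.36)/(21.27)
  (`VPDeterminantalQPProofs`: `DepthReduction.SLP.hasInvRepr_val`, `HasInvRepr.hasDetRepr`,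
  `succ_mul_invReprBound_le`) every `f ∈ VP_ℂ` has, level by level, an AFFINE DETERMINANTAL
  REPRESENTATION `f_n = det A_n` of size `m_n ≤ 2^(17 E_n²)` with `E_n = (log₂ n + 1)·A`
  (`hasDetRepr_two_pow`, `A` a family constant) — quasi-polynomial with the UNIFORM exponent `2`
  of `log n`, which one extra logarithm absorbs eventually (crux constant `C = 2 C₀ + 1`).
  [cite: BurgisserClausenShokrollahi1997, Thm. (21.27), Thm. (21.36), Cor. (21.40)]
* `stub_kwFormula` (KARCHMER–WIGDERSON, the easy direction; known, to be formalised, size M): a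
  deterministic two-party protocol tree of depth `D` solving the MONOTONE KW game of `h`
  (Alice holds `a ∈ h⁻¹(1)`, Bob `b ∈ h⁻¹(0)`, they agree on `i` with `a_i = 1, b_i = 0`) yields
  a monotone `{∧₂,∨₂}`-formula for `h` with at most `2^D` gates (induction on the tree:
  Alice node ↦ `∨`, Bob node ↦ `∧`, leaf `i` ↦ the input `x_i`).
  [cite: KarchmerWigderson1990] [cite: Jukna2012, §3.3 Thm. 3.13]
* `stub_detProtocol` (DETERMINANTAL SHADOW PROTOCOL — the load-bearing, conjecture-grade stub):
  there are `δ ∈ (0,1)` and `C` such that for every polynomial `g` over `ℂ` on a nonempty finite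
  variable set `ι` with an affine determinantal representation of size `m` (`HasDetRepr g m`)
  and `0/1` coefficients, the monotone KW game of the shadow of `g` has a protocol of depth at
  most `(deg g)^(1-δ) · (log(m + #ι + 2))^C + C`. Here Bob's inputs are exactly the variable sets
  `b` on which the symbolic matrix `A|_b` (variables outside `b` set to `0`) is GENERICALLY
  SINGULAR, and the `0/1` hypothesis says that the surviving permutation terms of ONE matrix have
  coherent signs — the setting of every known mechanism that turns sign-coherence into separator
  structure (Kasteleyn–Little–Robertson–Seymour–Thomas–McCuaig for Pfaffian bipartite graphs,
  Lindström–Brenti "totally nonnegative = planar network", Seymour/Whittle/Geelen–Gerards–Whittle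
  for unimodular and sixth-root-of-unity Gram determinants `det(U X U^*)`), and of the rank
  min–max theorems that give Bob succinct witnesses (Murota's mixed-matrix rank formula for the
  read-once blocks; non-commutative rank / shrunk subspaces as an always-sound relaxation).
  [cite: RazWigderson1992] [cite: arXiv:2512.19515, Thm. 1.4, §1.3] [cite: Valiant1979]
* `ShadowFormulaTransfer_of : Registered.stub_kwFormula → Registered.stub_detProtocol →
  ShadowFormulaTransfer` — the composition, proved here sorry-free: VP ⟹ affine determinantal
  representation of size `2^(17E²)` (tree) ⟹ protocol (stub) ⟹ formula (stub) ⟹ the crux bound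
  after absorbing `log(m_n + #σ n + 2) ≤ 304 A² (log(n+2))²` into one extra logarithm
  (threshold `n₀ = ⌈exp((304A²)^C₀)⌉`); the empty-variable levels are the junk value `0` of
  `formulaSizeOver` (`formulaSizeOver_monotoneBasis_of_isEmpty`, proved).

Disproof used: none exists for this crux (`ledger crux ls stmt-ValiantsHypothesis-17124`: only
`Lines/birth.*`; no `Disproof.lean`, no `_false_without_` theorem, no Negative lemma). Negatives
index (`ledger negatives --problem ValiantsHypothesis`): nothing on Boolean shadows / monotone
formula size / determinantal shadows. The hypotheses of `stub_detProtocol` are load-bearing: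
WITHOUT `HasDetRepr g m` in the bound (i.e. with no `m`) the statement says every 0/1 polynomial
has a shallow shadow and `per_m` (`PM_m`, Raz–Wigderson `2^{Ω(m)}`, route support
`RazWigdersonMatching`) kills it; WITHOUT the `0/1` hypothesis `det_m` itself (`m × m`, degree
`m`, shadow `PM_m`) kills it. TRANSFER (why the open stub is easier than the crux): (i) the
general circuit is gone — the object is a single matrix of affine forms, and `B(g)(a) = [A|_a is
generically nonsingular]` is a RANK condition; (ii) protocols are adaptive, the native language
both of the far side (RW92 = DISJ inside the PM game) and of every known upper bound (separator
binary search); (iii) in the read-once blocks Bob's witnesses are Murota deficient rectangles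
(König–Hall type), so the game is "find one of your variables inside my rectangle"; (iv) 0/1-ness
becomes sign-coherence of one determinant, where structure theorems exist (above). The census of
all known 0/1 VP families (planar/Pfaffian matchings, arborescences, regular-matroid and ⁶√1
Gram determinants, LGV/TN path families, IMM, e_d) consists of determinants of exactly this kind,
all with protocols of depth `Õ(√deg)` or `polylog` — consistent with `δ = 1/2`.
-/

set_option linter.dupNamespace false

noncomputable section

namespace Summit.ValiantsHypothesis.ValiantsHypothesis.Cruxes.ShadowFormulaTransfer.DetKw

open Summit.ValiantsHypothesis.ValiantsHypothesis.Theses.ShallowShadows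
open Literature.Computability.AlgebraicComplexity Literature.Computability.Complexity
open scoped Classical

/-! ## Deterministic protocol trees for monotone Karchmer–Wigderson games

RESHAPE (lead, 2026-08-17): the protocol trees `KWTree ι` (with `depth`, `run`, `SolvesMono`,
and the send-`k`-bits combinators `aliceChoose` / `bobChoose`) now live in the TREE, in
`Literature/Computability/Complexity/KWProtocol.lean` (p158156, namespace
`Literature.Computability.Complexity`, opened above), so that stub proofs under `Theorems/` can
import them; the local copies were deleted. The two stub signatures below are textually
unchanged and elaborate against the Literature declarations. -/

/-! ## The two stub statements, named -/

/-- **KW, protocol ⟹ formula** (stub statement, named): a protocol tree of depth `D` for the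
monotone KW game of `h` gives a monotone `{∧₂, ∨₂}`-formula for `h` with at most `2^D` gates.
(For non-monotone `h` no tree solves the game; for constant `h` the conclusion is the junk
value `0` of `formulaSizeOver`.) [known, to be formalised: KarchmerWigderson1990; Jukna2012 Thm. 3.13] -/
def KWFormula : Prop :=
  ∀ (ι : Type) [Fintype ι] (h : (ι → Bool) → Bool) (P : KWTree ι),
    P.SolvesMono h → formulaSizeOver monotoneBasis h ≤ 2 ^ P.depth

/-- **DETERMINANTAL SHADOW PROTOCOL** (stub statement, named; the line's bet): uniformly in the
instance, a `0/1`-coefficient polynomial with an affine determinantal representation of size `m`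
has a monotone KW protocol for its shadow of depth `(deg)^(1-δ) (log(m + #ι + 2))^C + C`.
[conjecture-grade: RazWigderson1992 (far side); arXiv:2512.19515 Thm. 1.4, §1.3; Valiant1979] -/
def DetProtocol : Prop :=
  ∃ δ : ℝ, 0 < δ ∧ δ < 1 ∧ ∃ C : ℕ, ∀ (ι : Type) [Fintype ι] [Nonempty ι]
    (g : MvPolynomial ι ℂ) (m : ℕ), HasDetRepr g m →
    (∀ mo : ι →₀ ℕ, g.coeff mo = 0 ∨ g.coeff mo = 1) →
    ∃ P : KWTree ι,
      P.SolvesMono (fun a : ι → Bool => decide (∃ mo ∈ g.support, ∀ i ∈ mo.support, a i = true)) ∧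
      (P.depth : ℝ) ≤ (g.totalDegree : ℝ) ^ (1 - δ) *
        (Real.log ((m : ℝ) + (Fintype.card ι : ℝ) + 2)) ^ C + C

/-! ### RESHAPE (lead, 2026-08-17, cycle 1): `DetProtocol` = TRIVIAL REGIMES + WINDOW

The monotone KW game of the shadow of ANY polynomial `g` on `N ≥ 1` variables has the two
trivial protocols "Alice names the support of her monomial as a `deg g`-tuple over `N + 1`
symbols, Bob names a variable of it" (depth `≤ deg g · ⌈log₂(N+1)⌉ + ⌈log₂ N⌉`) and "Alice sends
her set, Bob names a variable" (depth `≤ N + ⌈log₂ N⌉`) — no determinant, no `0/1` hypothesis.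
This is `ShadowTrivialProtocol`, PROVED in the tree
(`Theorems/ShallowShadowsShadowFormulaTransferDetProtocolRegimes.lean`, `exists_kwTree_shadow`,
on top of `Literature/Computability/Complexity/KWProtocolBounds.lean`). `DetProtocol` is then
EQUIVALENT to its restriction `DetProtocolWindow` to the instances on which the trivial depth
exceeds the budget `deg^(1-δ) (log(m+N+2))^C + C` — i.e. (up to constants) the window
`polylog(m+N) < deg < N^(1/(1-δ))` — and `detProtocol_of` below is that (easy) equivalence. The
window stub is where `HasDetRepr g m` and the `0/1` hypothesis must be used jointly; it is the
crux relocated onto one matrix (STRATEGY-CENSUS §S-d) and stays the line's open, load-bearing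
stub. Registered stubs after the reshape: `stub_kwFormula`, `stub_shadowTrivialProtocol`,
`stub_detProtocolWindow`. -/

/-- **TRIVIAL SHADOW PROTOCOLS** (stub statement, named; PROVED in the tree as
`Summit.ValiantsHypothesis.ValiantsHypothesis.Theorems.ShallowShadowsShadowFormulaTransfer.exists_kwTree_shadow`):
for every polynomial `g` over `ℂ` on a nonempty finite variable set of size `N`, the monotone KW
game of its shadow has a protocol of depth
`≤ min (deg g · ⌈log₂(N+1)⌉ + ⌈log₂ N⌉) (N + ⌈log₂ N⌉)`. [cite: KarchmerWigderson1990, §2] -/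
def ShadowTrivialProtocol : Prop :=
  ∀ (ι : Type) [Fintype ι] [Nonempty ι] (g : MvPolynomial ι ℂ),
    ∃ P : KWTree ι,
      P.SolvesMono (fun a : ι → Bool => decide (∃ mo ∈ g.support, ∀ i ∈ mo.support, a i = true)) ∧
      P.depth ≤ min (g.totalDegree * Nat.clog 2 (Fintype.card ι + 1) + Nat.clog 2 (Fintype.card ι))
        (Fintype.card ι + Nat.clog 2 (Fintype.card ι))

/-- **DETERMINANTAL SHADOW PROTOCOL IN THE WINDOW** (stub statement, named; the line's bet after
the reshape): as `DetProtocol`, restricted to the instances `(g, m)` on which both trivial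
protocols are longer than the budget `deg^(1-δ) (log(m + #ι + 2))^C + C`. Equivalent to
`DetProtocol` (`detProtocol_of`); conjecture-grade.
[conjecture-grade: RazWigderson1992 (far side); arXiv:2512.19515 Thm. 1.4, §1.3; Valiant1979] -/
def DetProtocolWindow : Prop :=
  ∃ δ : ℝ, 0 < δ ∧ δ < 1 ∧ ∃ C : ℕ, ∀ (ι : Type) [Fintype ι] [Nonempty ι]
    (g : MvPolynomial ι ℂ) (m : ℕ), HasDetRepr g m →
    (∀ mo : ι →₀ ℕ, g.coeff mo = 0 ∨ g.coeff mo = 1) →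
    (g.totalDegree : ℝ) ^ (1 - δ) * (Real.log ((m : ℝ) + (Fintype.card ι : ℝ) + 2)) ^ C + C <
      ((min (g.totalDegree * Nat.clog 2 (Fintype.card ι + 1) + Nat.clog 2 (Fintype.card ι))
        (Fintype.card ι + Nat.clog 2 (Fintype.card ι)) : ℕ) : ℝ) →
    ∃ P : KWTree ι,
      P.SolvesMono (fun a : ι → Bool => decide (∃ mo ∈ g.support, ∀ i ∈ mo.support, a i = true)) ∧
      (P.depth : ℝ) ≤ (g.totalDegree : ℝ) ^ (1 - δ) *
        (Real.log ((m : ℝ) + (Fintype.card ι : ℝ) + 2)) ^ C + C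

/-- Stub KW (registered obligation; signature = `KWFormula` verbatim). LANDED (worker, cycle 1):
`Theorems/ShallowShadowsShadowFormulaTransferStubKwFormula.lean` (p159284) on top of the
Literature theorem `KWTree.formulaSizeOver_le_two_pow_depth` (`KWProtocolFormula.lean`, p158900).
[cite: KarchmerWigderson1990] [cite: JuknaBFC2012, §3.3 Thm. 3.13] -/
theorem stub_kwFormula :
    ∀ (ι : Type) [Fintype ι] (h : (ι → Bool) → Bool) (P : KWTree ι),
      P.SolvesMono h → formulaSizeOver monotoneBasis h ≤ 2 ^ P.depth :=
  _root_.Summit.ValiantsHypothesis.ValiantsHypothesis.Theorems.ShallowShadowsShadowFormulaTransfer.stub_kwFormula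

/-- Stub ShadowTrivialProtocol (registered obligation; signature = `ShadowTrivialProtocol`
verbatim). LANDED (lead, cycle 1): `Theorems/ShallowShadowsShadowFormulaTransferDetProtocolRegimes.lean`
(p159593) on top of `Literature/Computability/Complexity/KWProtocolBounds.lean` (p158768).
[cite: KarchmerWigderson1990, §2] -/
theorem stub_shadowTrivialProtocol :
    ∀ (ι : Type) [Fintype ι] [Nonempty ι] (g : MvPolynomial ι ℂ),
      ∃ P : KWTree ι,
        P.SolvesMono (fun a : ι → Bool => decide (∃ mo ∈ g.support, ∀ i ∈ mo.support, a i = true)) ∧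
        P.depth ≤ min (g.totalDegree * Nat.clog 2 (Fintype.card ι + 1) + Nat.clog 2 (Fintype.card ι))
          (Fintype.card ι + Nat.clog 2 (Fintype.card ι)) := by
  intro ι _ _ g
  obtain ⟨P, hsol, hdepth⟩ :=
    _root_.Summit.ValiantsHypothesis.ValiantsHypothesis.Theorems.ShallowShadowsShadowFormulaTransfer.stub_shadowTrivialProtocol
      ι g
  -- the landed statement and this one spell the shadow with different `Decidable` instances
  -- (here `open scoped Classical` + `Fintype ι` are in scope); bridge through the propositions
  exact ⟨P, fun a b ha hb => hsol a b (by simpa using ha) (by simpa using hb), hdepth⟩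

/-- Stub DetProtocolWindow (registered obligation; signature = `DetProtocolWindow` verbatim).
[conjecture-grade: RazWigderson1992; arXiv:2512.19515; Valiant1979] -/
theorem stub_detProtocolWindow :
    ∃ δ : ℝ, 0 < δ ∧ δ < 1 ∧ ∃ C : ℕ, ∀ (ι : Type) [Fintype ι] [Nonempty ι]
      (g : MvPolynomial ι ℂ) (m : ℕ), HasDetRepr g m →
      (∀ mo : ι →₀ ℕ, g.coeff mo = 0 ∨ g.coeff mo = 1) →
      (g.totalDegree : ℝ) ^ (1 - δ) * (Real.log ((m : ℝ) + (Fintype.card ι : ℝ) + 2)) ^ C + C <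
        ((min (g.totalDegree * Nat.clog 2 (Fintype.card ι + 1) + Nat.clog 2 (Fintype.card ι))
          (Fintype.card ι + Nat.clog 2 (Fintype.card ι)) : ℕ) : ℝ) →
      ∃ P : KWTree ι,
        P.SolvesMono (fun a : ι → Bool => decide (∃ mo ∈ g.support, ∀ i ∈ mo.support, a i = true)) ∧
        (P.depth : ℝ) ≤ (g.totalDegree : ℝ) ^ (1 - δ) *
          (Real.log ((m : ℝ) + (Fintype.card ι : ℝ) + 2)) ^ C + C := by
  sorry

/-! ## Name-keyed aliases of the stub statements (hypotheses of the composition) -/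
namespace Registered

/-- Alias of `KWFormula` (= the signature of `stub_kwFormula`). -/
abbrev stub_kwFormula : Prop := KWFormula
/-- Alias of `ShadowTrivialProtocol` (= the signature of `stub_shadowTrivialProtocol`). -/
abbrev stub_shadowTrivialProtocol : Prop := ShadowTrivialProtocol
/-- Alias of `DetProtocolWindow` (= the signature of `stub_detProtocolWindow`). -/
abbrev stub_detProtocolWindow : Prop := DetProtocolWindow

end Registered

/-- **`DetProtocol` from its window** (the reshape's glue, kernel-checked): outside the window
the trivial protocols meet the budget, inside it the window stub does. [folklore] -/
theorem detProtocol_of :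
    Registered.stub_shadowTrivialProtocol → Registered.stub_detProtocolWindow → DetProtocol := by
  intro hT hW
  obtain ⟨δ, hδ0, hδ1, C, hC⟩ := hW
  refine ⟨δ, hδ0, hδ1, C, ?_⟩
  intro ι _ _ g m hrepr h01
  by_cases hlt : (g.totalDegree : ℝ) ^ (1 - δ) *
      (Real.log ((m : ℝ) + (Fintype.card ι : ℝ) + 2)) ^ C + C <
      ((min (g.totalDegree * Nat.clog 2 (Fintype.card ι + 1) + Nat.clog 2 (Fintype.card ι))
        (Fintype.card ι + Nat.clog 2 (Fintype.card ι)) : ℕ) : ℝ)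
  · exact hC ι g m hrepr h01 hlt
  · obtain ⟨P, hsol, hdepth⟩ := hT ι g
    refine ⟨P, hsol, ?_⟩
    have h1 : (P.depth : ℝ) ≤ ((min (g.totalDegree * Nat.clog 2 (Fintype.card ι + 1) +
        Nat.clog 2 (Fintype.card ι)) (Fintype.card ι + Nat.clog 2 (Fintype.card ι)) : ℕ) : ℝ) := by
      exact_mod_cast hdepth
    exact h1.trans (not_lt.mp hlt)

/-! ## Proved glue 1: VP ⟹ affine determinantal representations of size `2^(17E²)` (tree) -/

/-- **Affine determinantal representation from circuit size and degree** (the `HasDetRepr`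
form of the tree's `determinantalComplexity_le_two_pow`, BCS 1997 Thm. (21.36) with Thm.
(21.27)): if `deg g ≤ d < 2^E`, `L(g) ≤ 2^E`, `1 ≤ E`, then `g = det A` for an affine matrix
of size `2^(17 E²)`. [cite: BurgisserClausenShokrollahi1997, Thm. (21.36) and Thm. (21.27)] -/
theorem hasDetRepr_two_pow {σ : Type} {g : MvPolynomial σ ℂ} {d E : ℕ}
    (hdeg : g.totalDegree ≤ d) (hd : d < 2 ^ E) (hL : complexity g ≤ 2 ^ E) (hE : 1 ≤ E) :
    HasDetRepr g (2 ^ (17 * E ^ 2)) := by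
  classical
  obtain ⟨P, hfan, hcomp, hsize⟩ := ArithCircuit.exists_computes_size_eq_complexity g
  obtain ⟨S, hlen, hcases⟩ := DepthReduction.exists_slp P hfan
  rw [show P.eval = g from hcomp] at hcases
  have h3 : 3 ≤ 2 ^ (17 * E ^ 2) := by
    calc 3 ≤ 2 ^ 2 := by norm_num
      _ ≤ 2 ^ (17 * E ^ 2) := Nat.pow_le_pow_right (by norm_num) (by nlinarith)
  have haff : ∀ a : MvPolynomial σ ℂ, a.totalDegree ≤ 1 → HasDetRepr a 3 :=
    fun a ha => (HasInvRepr.of_totalDegree_le_one ha).hasDetRepr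
  rcases hcases with ⟨i, hi, hgi⟩ | ⟨j, hgj⟩ | ⟨c, hgc⟩
  · have hdi : (S.val i).totalDegree ≤ d := by rw [← hgi]; exact hdeg
    have hrepr := DepthReduction.SLP.hasInvRepr_val S d hi hdi
    rw [← hgi] at hrepr
    have hSlen : S.len ≤ 2 ^ E := by rw [hlen, hsize]; exact hL
    exact HasDetRepr.mono_holds hrepr.hasDetRepr (succ_mul_invReprBound_le hd hSlen hE)
  · rw [hgj]
    exact HasDetRepr.mono_holds
      (haff _ (MvPolynomial.isHomogeneous_X ℂ j).totalDegree_le) h3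
  · rw [hgc]
    exact HasDetRepr.mono_holds (haff _ (by simp)) h3

/-- **VP families, levelwise** (Bürgisser 2000 Def. 2.4 + the above): a `VP_ℂ` family has a
constant `A ≥ 1` such that with `E n = (log₂ n + 1) A` every level has
`deg f_n < 2^(E n)`, `#σ n < 2^(E n)` and `f_n = det` of an affine matrix of size `2^(17 (E n)²)`.
[cite: BurgisserClausenShokrollahi1997, Cor. (21.40)] [cite: Burgisser2000, Def. 2.4] -/
theorem exists_hasDetRepr_levels (σ : ℕ → Type) [∀ n, Fintype (σ n)]
    (f : ∀ n, MvPolynomial (σ n) ℂ) (hf : IsVPFamily f) :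
    ∃ A : ℕ, 1 ≤ A ∧ ∀ n, Fintype.card (σ n) < 2 ^ ((Nat.log 2 n + 1) * A) ∧
      (f n).totalDegree < 2 ^ ((Nat.log 2 n + 1) * A) ∧
      HasDetRepr (f n) (2 ^ (17 * ((Nat.log 2 n + 1) * A) ^ 2)) := by
  obtain ⟨⟨hvars, hdegp⟩, hLp⟩ := hf
  obtain ⟨A₁, hA₁, hdeg⟩ := IsPBounded.exists_lt_two_pow hdegp
  obtain ⟨A₂, -, hL⟩ := IsPBounded.exists_lt_two_pow hLp
  obtain ⟨A₃, -, hV⟩ := IsPBounded.exists_lt_two_pow hvars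
  refine ⟨A₁ + A₂ + A₃, by omega, fun n => ?_⟩
  set E := (Nat.log 2 n + 1) * (A₁ + A₂ + A₃) with hE
  have hE1 : 1 ≤ E := Nat.one_le_iff_ne_zero.2 (Nat.mul_ne_zero (by omega) (by omega))
  have hEd : (Nat.log 2 n + 1) * A₁ ≤ E := Nat.mul_le_mul_left _ (by omega)
  have hEL : (Nat.log 2 n + 1) * A₂ ≤ E := Nat.mul_le_mul_left _ (by omega)
  have hEV : (Nat.log 2 n + 1) * A₃ ≤ E := Nat.mul_le_mul_left _ (by omega)
  have hd : (f n).totalDegree < 2 ^ E :=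
    (hdeg n).trans_le (Nat.pow_le_pow_right (by norm_num) hEd)
  have hc : complexity (f n) ≤ 2 ^ E :=
    ((hL n).trans_le (Nat.pow_le_pow_right (by norm_num) hEL)).le
  have hv : Fintype.card (σ n) < 2 ^ E :=
    (hV n).trans_le (Nat.pow_le_pow_right (by norm_num) hEV)
  exact ⟨hv, hd, hasDetRepr_two_pow le_rfl hd hc hE1⟩

/-! ## Proved glue 2: no monotone formula exists over an empty variable set -/

/-- Over an EMPTY variable set there is no circuit over the monotone basis `{∧₂, ∨₂}` at all
(the first gate would need an input wire or an earlier gate), so `formulaSizeOver` is its junk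
value `0`. [folklore] -/
theorem formulaSizeOver_monotoneBasis_of_isEmpty {ι : Type} [IsEmpty ι]
    (h : (ι → Bool) → Bool) : formulaSizeOver monotoneBasis h = 0 := by
  unfold formulaSizeOver
  convert Nat.sInf_empty using 2
  ext s
  simp only [Set.mem_setOf_eq, Set.mem_empty_iff_false, iff_false, not_exists, not_and]
  intro C hB _ _ _
  -- a circuit over `monotoneBasis` on an empty variable set cannot exist
  exfalso
  have harity : ∀ g ∈ C.gates, g.arity = 2 := by
    intro g hg
    have hfn := hB g hg
    simp only [monotoneBasis, Set.mem_insert_iff, Set.mem_singleton_iff, Gate.fn, GateFn.and,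
      GateFn.or] at hfn
    rcases hfn with h1 | h1 <;> exact congrArg Sigma.fst h1
  cases hout : C.output with
  | inl i => exact IsEmpty.false i
  | inr m =>
    have hm : m < C.gates.length := C.wf_output m hout
    have hlen : 0 < C.gates.length := by omega
    have hg0 : C.gates[0] ∈ C.gates := List.getElem_mem hlen
    have ha : (C.gates[0]).arity = 2 := harity _ hg0
    set g := C.gates[0] with hg
    have hpos : 0 < g.arity := by omega
    cases harg : g.args ⟨0, hpos⟩ with
    | inl i => exact IsEmpty.false i
    | inr m' =>
      have := C.wf 0 hlen ⟨0, hpos⟩ m' harg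
      omega

/-! ## Proved glue 3: elementary estimates for the absorption -/

/-- `log₂ n ≤ 2 log (n + 2)` (natural logarithm), from `2^(log₂ n) ≤ n + 1`. [folklore] -/
theorem natLog_le_two_mul_log (n : ℕ) : (Nat.log 2 n : ℝ) ≤ 2 * Real.log ((n : ℝ) + 2) := by
  have h1 : (2 : ℝ) ^ (Nat.log 2 n) ≤ (n : ℝ) + 2 := by
    have := Nat.pow_log_le_add_one 2 n
    have h' : ((2 ^ Nat.log 2 n : ℕ) : ℝ) ≤ ((n + 1 : ℕ) : ℝ) := by exact_mod_cast this
    push_cast at h'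
    linarith
  have h2 : Real.log ((2 : ℝ) ^ (Nat.log 2 n)) ≤ Real.log ((n : ℝ) + 2) :=
    Real.log_le_log (by positivity) h1
  rw [Real.log_pow] at h2
  have hlog2 : (1 : ℝ) / 2 ≤ Real.log 2 := by
    have := Real.log_two_gt_d9
    linarith
  have h0 : (0 : ℝ) ≤ Nat.log 2 n := by positivity
  nlinarith

/-- `1 ≤ 2 log (n + 2)`. [folklore] -/
theorem one_le_two_mul_log (n : ℕ) : (1 : ℝ) ≤ 2 * Real.log ((n : ℝ) + 2) := by
  have hn0 : (0 : ℝ) ≤ n := by positivity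
  have h2 : Real.log 2 ≤ Real.log ((n : ℝ) + 2) :=
    Real.log_le_log (by norm_num) (by linarith)
  have := Real.log_two_gt_d9
  linarith

/-- The size absorption in `ℕ`: `2^(17E²) + v + 2 ≤ 2^(19 E²)` for `v < 2^E`, `1 ≤ E`. [folklore] -/
theorem two_pow_add_card_le {E v : ℕ} (hE : 1 ≤ E) (hv : v < 2 ^ E) :
    2 ^ (17 * E ^ 2) + v + 2 ≤ 2 ^ (19 * E ^ 2) := by
  have h1 : v + 2 ≤ 2 ^ E + 2 ^ E := by
    have : 1 ≤ 2 ^ E := Nat.one_le_two_pow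
    omega
  have h2 : 2 ^ E ≤ 2 ^ (17 * E ^ 2) := Nat.pow_le_pow_right (by norm_num) (by nlinarith)
  have h4 : 2 ^ (17 * E ^ 2) * 4 ≤ 2 ^ (19 * E ^ 2) := by
    have : 2 ^ (19 * E ^ 2) = 2 ^ (17 * E ^ 2) * 2 ^ (2 * E ^ 2) := by
      rw [← pow_add]; ring_nf
    rw [this]
    refine Nat.mul_le_mul_left _ ?_
    calc 4 = 2 ^ 2 := by norm_num
      _ ≤ 2 ^ (2 * E ^ 2) := Nat.pow_le_pow_right (by norm_num) (by nlinarith)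
  omega

/-- The logarithmic absorption: with `m = 2^(17E²)`, `v < 2^E`, `E = (log₂ n + 1) A`,
`log (m + v + 2) ≤ 304 A² (log (n+2))²`. [folklore] -/
theorem log_size_le {n A v : ℕ} (hA : 1 ≤ A) (hv : v < 2 ^ ((Nat.log 2 n + 1) * A)) :
    Real.log (((2 ^ (17 * ((Nat.log 2 n + 1) * A) ^ 2) : ℕ) : ℝ) + (v : ℝ) + 2) ≤
      304 * (A : ℝ) ^ 2 * Real.log ((n : ℝ) + 2) ^ 2 := by
  obtain ⟨E, hE⟩ : ∃ E : ℕ, E = (Nat.log 2 n + 1) * A := ⟨_, rfl⟩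
  rw [← hE] at hv ⊢
  have hE1 : 1 ≤ E := by
    rw [hE]; exact Nat.one_le_iff_ne_zero.2 (Nat.mul_ne_zero (by omega) (by omega))
  have hN := two_pow_add_card_le hE1 hv
  have hR : ((2 ^ (17 * E ^ 2) : ℕ) : ℝ) + (v : ℝ) + 2 ≤ (2 : ℝ) ^ (19 * E ^ 2) := by
    exact_mod_cast hN
  have hpos : (0 : ℝ) < ((2 ^ (17 * E ^ 2) : ℕ) : ℝ) + (v : ℝ) + 2 := by positivity
  have hlog : Real.log (((2 ^ (17 * E ^ 2) : ℕ) : ℝ) + (v : ℝ) + 2) ≤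
      ((19 * E ^ 2 : ℕ) : ℝ) * Real.log 2 := by
    calc Real.log (((2 ^ (17 * E ^ 2) : ℕ) : ℝ) + (v : ℝ) + 2)
        ≤ Real.log ((2 : ℝ) ^ (19 * E ^ 2)) := Real.log_le_log hpos hR
      _ = ((19 * E ^ 2 : ℕ) : ℝ) * Real.log 2 := by rw [Real.log_pow]
  have hlog2 : Real.log 2 ≤ 1 := by
    have := Real.log_two_lt_d9
    linarith
  -- E ≤ 4 A log(n+2)
  have hElog : (E : ℝ) ≤ 4 * (A : ℝ) * Real.log ((n : ℝ) + 2) := by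
    have h1 := natLog_le_two_mul_log n
    have h2 := one_le_two_mul_log n
    have hA0 : (0 : ℝ) ≤ A := by positivity
    have hE' : (E : ℝ) = ((Nat.log 2 n : ℝ) + 1) * A := by
      rw [hE]; push_cast; ring
    rw [hE']
    have h3 : (Nat.log 2 n : ℝ) + 1 ≤ 4 * Real.log ((n : ℝ) + 2) := by linarith
    nlinarith
  have hE0 : (0 : ℝ) ≤ E := by positivity
  have hL0 : (0 : ℝ) ≤ Real.log ((n : ℝ) + 2) := Real.log_nonneg (by
    have : (0 : ℝ) ≤ n := by positivity
    linarith)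
  have hEsq : (E : ℝ) ^ 2 ≤ 16 * (A : ℝ) ^ 2 * Real.log ((n : ℝ) + 2) ^ 2 := by
    have h4A : (0 : ℝ) ≤ 4 * (A : ℝ) * Real.log ((n : ℝ) + 2) := mul_nonneg (by positivity) hL0
    have := mul_le_mul hElog hElog hE0 h4A
    nlinarith
  have h19 : (0 : ℝ) ≤ ((19 * E ^ 2 : ℕ) : ℝ) := by positivity
  calc Real.log (((2 ^ (17 * E ^ 2) : ℕ) : ℝ) + (v : ℝ) + 2)
      ≤ ((19 * E ^ 2 : ℕ) : ℝ) * Real.log 2 := hlog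
    _ ≤ ((19 * E ^ 2 : ℕ) : ℝ) * 1 := mul_le_mul_of_nonneg_left hlog2 h19
    _ = 19 * (E : ℝ) ^ 2 := by push_cast; ring
    _ ≤ 19 * (16 * (A : ℝ) ^ 2 * Real.log ((n : ℝ) + 2) ^ 2) := by nlinarith
    _ = 304 * (A : ℝ) ^ 2 * Real.log ((n : ℝ) + 2) ^ 2 := by ring

/-! ## The composition -/

/-- **Composition** (the glue of the line, kernel-checked; after the cycle-1 reshape the three
registered stubs first give `DetProtocol` through `detProtocol_of`): KW (protocol ⟹ formula) and
the determinantal shadow protocol give the crux with constants `δ`, `2 C₀ + 1`: every level of a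
`0/1` VP family is `det` of an affine matrix of size `m = 2^(17E²)` (tree), the protocol of the
stub for that matrix has depth `≤ deg^(1-δ) (log(m + #σ n + 2))^C₀ + C₀`, the KW stub turns it
into a formula of size `≤ 2^depth`, and `(log(m + #σ n + 2))^C₀ ≤ (304A²)^C₀ (log(n+2))^(2C₀)
≤ (log(n+2))^(2C₀+1)` once `log(n+2) ≥ (304A²)^C₀`. Empty variable sets contribute the junk
value `0`. [folklore] -/
theorem ShadowFormulaTransfer_of :
    Registered.stub_detProtocolWindow → ShadowFormulaTransfer := by
  intro hW
  -- the two LANDED stubs are discharged here (tree theorems, wired through the stub decls above)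
  have hKW : Registered.stub_kwFormula := stub_kwFormula
  have hT : Registered.stub_shadowTrivialProtocol := stub_shadowTrivialProtocol
  have hDP : DetProtocol := detProtocol_of hT hW
  obtain ⟨δ, hδ0, hδ1, C₀, hC⟩ := hDP
  refine ⟨δ, hδ0, 2 * C₀ + 1, ?_⟩
  intro σ _ _ f hVP h01
  obtain ⟨A, hA, hlev⟩ := exists_hasDetRepr_levels σ f hVP
  -- the family constant K = 304 A² and the threshold log (n + 2) ≥ K ^ C₀
  obtain ⟨K, hK⟩ : ∃ K : ℝ, K = 304 * (A : ℝ) ^ 2 := ⟨_, rfl⟩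
  refine ⟨⌈Real.exp (K ^ C₀)⌉₊, fun n hn => ?_⟩
  have hK1 : (1 : ℝ) ≤ K := by
    have : (1 : ℝ) ≤ A := by exact_mod_cast hA
    rw [hK]; nlinarith
  have hLn_ge : K ^ C₀ ≤ Real.log ((n : ℝ) + 2) := by
    rw [Real.le_log_iff_exp_le (by positivity)]
    have h1 : Real.exp (K ^ C₀) ≤ ⌈Real.exp (K ^ C₀)⌉₊ := Nat.le_ceil _
    have h2 : (⌈Real.exp (K ^ C₀)⌉₊ : ℝ) ≤ n := by exact_mod_cast hn
    linarith
  have hKC1 : (1 : ℝ) ≤ K ^ C₀ := one_le_pow₀ hK1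
  have hLn_pos : 0 < Real.log ((n : ℝ) + 2) := by linarith
  obtain ⟨hv, hd, hrepr⟩ := hlev n
  have hlog0 := log_size_le (n := n) (v := Fintype.card (σ n)) hA hv
  -- abbreviate the matrix size
  obtain ⟨m, hmdef⟩ : ∃ m : ℕ, m = 2 ^ (17 * ((Nat.log 2 n + 1) * A) ^ 2) := ⟨_, rfl⟩
  rw [← hmdef] at hrepr hlog0
  rw [← hK] at hlog0
  by_cases hne : Nonempty (σ n)
  · -- the protocol of the stub, then KW
    obtain ⟨P, hsol, hdepth⟩ := @hC (σ n) _ hne (f n) m hrepr (h01 n)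
    have hsize := hKW (σ n) _ P hsol
    have hsizeR := (Nat.cast_le (α := ℝ)).mpr hsize
    push_cast at hsizeR
    rw [← Real.rpow_natCast] at hsizeR
    -- absorb the logarithm
    have hlogm0 : 0 ≤ Real.log ((m : ℝ) + (Fintype.card (σ n) : ℝ) + 2) :=
      Real.log_nonneg (by
        have : (0 : ℝ) ≤ (m : ℝ) + (Fintype.card (σ n) : ℝ) := by positivity
        linarith)
    have hpowC : Real.log ((m : ℝ) + (Fintype.card (σ n) : ℝ) + 2) ^ C₀ ≤
        Real.log ((n : ℝ) + 2) ^ (2 * C₀ + 1) := by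
      calc Real.log ((m : ℝ) + (Fintype.card (σ n) : ℝ) + 2) ^ C₀
          ≤ (K * Real.log ((n : ℝ) + 2) ^ 2) ^ C₀ := pow_le_pow_left₀ hlogm0 hlog0 C₀
        _ = K ^ C₀ * Real.log ((n : ℝ) + 2) ^ (2 * C₀) := by rw [mul_pow, ← pow_mul]
        _ ≤ Real.log ((n : ℝ) + 2) * Real.log ((n : ℝ) + 2) ^ (2 * C₀) :=
            mul_le_mul_of_nonneg_right hLn_ge (pow_nonneg hLn_pos.le _)
        _ = Real.log ((n : ℝ) + 2) ^ (2 * C₀ + 1) := by rw [pow_succ']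
    have hexp : ((f n).totalDegree : ℝ) ^ (1 - δ) *
        Real.log ((m : ℝ) + (Fintype.card (σ n) : ℝ) + 2) ^ C₀ + (C₀ : ℝ) ≤
        ((f n).totalDegree : ℝ) ^ (1 - δ) * Real.log ((n : ℝ) + 2) ^ (2 * C₀ + 1) +
          ((2 * C₀ + 1 : ℕ) : ℝ) := by
      have hm1 := mul_le_mul_of_nonneg_left hpowC
        (Real.rpow_nonneg (by positivity : (0 : ℝ) ≤ ((f n).totalDegree : ℝ)) (1 - δ))
      push_cast
      linarith
    have t1 : (2 : ℝ) ^ (P.depth : ℝ) ≤ 2 ^ (((f n).totalDegree : ℝ) ^ (1 - δ) *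
        Real.log ((n : ℝ) + 2) ^ (2 * C₀ + 1) + ((2 * C₀ + 1 : ℕ) : ℝ)) :=
      (Real.rpow_le_rpow_of_exponent_le (by norm_num) hdepth).trans
        (Real.rpow_le_rpow_of_exponent_le (by norm_num) hexp)
    refine le_trans ?_ t1
    -- the two spellings of the shadow agree pointwise (their `Decidable` instances may differ,
    -- so we compare the Boolean functions with `decide_eq_decide`, never by `rfl`)
    have e : ∀ {x y : ℝ}, x = y → y ≤ (2 : ℝ) ^ (P.depth : ℝ) → x ≤ (2 : ℝ) ^ (P.depth : ℝ) :=
      fun h1 h2 => h1 ▸ h2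
    refine e ?_ hsizeR
    exact congrArg (fun B : (σ n → Bool) → Bool => (formulaSizeOver monotoneBasis B : ℝ))
      (funext fun a => decide_eq_decide.mpr Iff.rfl)
  · -- empty variable set: no monotone formula, junk value 0
    have hem : IsEmpty (σ n) := not_nonempty_iff.mp hne
    rw [formulaSizeOver_monotoneBasis_of_isEmpty]
    push_cast
    exact Real.rpow_nonneg (by norm_num) _

/-- Wiring check: after cycle 1 the skeleton is `ShadowFormulaTransfer` closed modulo the ONE
remaining stub `stub_detProtocolWindow` (the only `sorry` in this file). -/
example : ShadowFormulaTransfer :=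
  ShadowFormulaTransfer_of stub_detProtocolWindow

end Summit.ValiantsHypothesis.ValiantsHypothesis.Cruxes.ShadowFormulaTransfer.DetKw

end
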